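import Literature.Computability.Complexity.KarpCliqueNP
import Literature.Computability.Complexity.KarpCliqueGadget
import Literature.Computability.Complexity.KarpCliqueTokens
import Literature.Computability.Complexity.KSATReductions
import HarnessLib

/-!
# `SAT ≤ₚ CLIQUE`: Karp's reduction `SATISFIABILITY ∝ CLIQUE` in polynomial time (Karp 1972, §4)

Machine half of the discharge of `Literature.Computability.Complexity.isNPComplete_CLIQUE`
(`KarpProblems.lean`). Karp (1972, §4, proof of the Main Theorem): "SATISFIABILITY ∝ CLIQUE.
`N = {⟨σ, i⟩ | σ is a literal and occurs in Cᵢ}`, `A = {{⟨σ, i⟩, ⟨δ, j⟩} | i ≠ j and σ ≠ δ̄}`,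
`k = p`, the number of clauses." The combinatorial correctness of this map is
`KarpClique.karp_clique_iff_annot` (`KarpCliqueGadget.lean`); here it is computed on the tree's
codes (`encodingCNF` ↦ `encodingGraph.pairBool encodingNatBool`) by a string function in `FP`,
assembled in the tree's algebra of `FP` string functions (no machine is written):

* the **tokenizer** `CNFTok.tokFn` of `KarpCliqueTokens.lean` reads the literal occurrences
  `toks z` of any string `z` (`toks_encode`: on the code of `φ` these are the literals of `φ` in
  order, each flagged if it opens a clause; `clauseCount_encode`: and it counts the clauses, `p`);
* the **adjacency emitter** `adjE` (one bit: Karp's "`i ≠ j` and `σ ≠ δ̄`" on a descriptor `desc` of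
  two token records with their clause numbers, `adjE_desc`), run by a **clause-counting row loop**
  `crowStep`/`crowFn` (the row loop `CNFIsing.rowStepB` of `SignProblemNPHardMachines.lean` with the
  column-position register replaced by the running clause number `1^{#flags so far}`) nested in a
  clause-counting **matrix loop** `cmatStep`/`cmatFn` (one row per record); their models
  `crowM`/`cmatM` and the bridge `cmatM_adjE_eq`/`adjBits_graphOf`: the emitted `L × L` bits are the adjacency bits
  (`CliqueNP.adjBits`) of Karp's graph `KarpClique.graphOf (annFrom 0 (toks z))` on the annotated
  occurrences (`annFrom`, running clause numbers `clsSeq`; `annFrom_tokensStr`: on the code of `φ`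
  this is `KarpClique.annot 0 φ`);
* **`redFn ∈ FP`** with `redFn z = code (⟨L, graphOf (annFrom 0 (toks z))⟩, clauseCount z)` on EVERY
  string (`redFn_apply`), and the guarded map `satToCliqueFn` (canonical CNF codes, tested by
  `KSATRed.isCanonFn`, go through `redFn`; other strings to the code of the no-instance
  `(⟨0, ⊥⟩, 1)`), whence **`SAT_karpReducible_CLIQUE : SAT ≤ₚ CLIQUE`**.

## References

* R. M. Karp, *Reducibility among combinatorial problems*, in: R. E. Miller, J. W. Thatcher (eds.),
  Complexity of Computer Computations, Plenum 1972, 85–103, §4 (Main Theorem; SATISFIABILITY ∝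
  CLIQUE), Lemma 2 (reductions between encoded problems).
* S. Arora, B. Barak, *Computational Complexity: A Modern Approach*, CUP 2009, §1.3 (polynomial
  time is closed under composition and bounded loops), §0.1 (codes), Def. 2.7 (Karp reductions).
-/

noncomputable section

namespace Literature.Computability.Complexity

open _root_.Computability Brick OracleCompose HashBricks Polynomial CNFTok CliqueNP

namespace KarpClique

/-! ### Column descriptors and their tests -/

/-- The descriptor `⟨row record, ⟨1^{i}, ⟨column record, 1^{j}⟩⟩⟩` handed to the emitter: the two token
records with their clause numbers in unary. [folklore] -/
def desc (trow P tcol Q : List Bool) : List Bool :=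
  boolPair trow (boolPair P (boolPair tcol Q))

/-- Test: equal variable names. [folklore] -/
def numEqT : List Bool → List Bool := eqPairFn ∘ fanoutFn (nthF 0 ∘ nthF 0) (nthF 0 ∘ nthF 2)

/-- Test: equal polarities. [folklore] -/
def polEqT : List Bool → List Bool := eqPairFn ∘ fanoutFn (nthF 1 ∘ nthF 0) (nthF 1 ∘ nthF 2)

/-- Test: equal clause numbers (column register equals row register). [folklore] -/
def clsEqT : List Bool → List Bool := eqPairFn ∘ fanoutFn (sndPow 2) (nthF 1)

/-- `numEqT ∈ FP`. [folklore] -/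
theorem numEqT_mem_FP : numEqT ∈ FP :=
  comp_mem_FP eqPairFn_mem_FP (fanoutFn_mem_FP (comp_mem_FP (nthF_mem_FP 0) (nthF_mem_FP 0))
    (comp_mem_FP (nthF_mem_FP 0) (nthF_mem_FP 2)))

/-- `polEqT ∈ FP`. [folklore] -/
theorem polEqT_mem_FP : polEqT ∈ FP :=
  comp_mem_FP eqPairFn_mem_FP (fanoutFn_mem_FP (comp_mem_FP (nthF_mem_FP 1) (nthF_mem_FP 0))
    (comp_mem_FP (nthF_mem_FP 1) (nthF_mem_FP 2)))

/-- `clsEqT ∈ FP`. [folklore] -/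
theorem clsEqT_mem_FP : clsEqT ∈ FP :=
  comp_mem_FP eqPairFn_mem_FP (fanoutFn_mem_FP (sndPow_mem_FP 2) (nthF_mem_FP 1))

/-- `numEqT` is one-bit. [folklore] -/
theorem oneBit_numEqT : OneBit numEqT := oneBit_eqPairFn.comp _
/-- `polEqT` is one-bit. [folklore] -/
theorem oneBit_polEqT : OneBit polEqT := oneBit_eqPairFn.comp _
/-- `clsEqT` is one-bit. [folklore] -/
theorem oneBit_clsEqT : OneBit clsEqT := oneBit_eqPairFn.comp _

section TestValues

variable (t t' : STok) (P Q : List Bool)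

/-- Value of the variable test on a descriptor. [folklore] -/
theorem numEqT_desc : numEqT (desc (tokRec t) P (tokRec t') Q) = [decide (t.var = t'.var)] := by
  simp [numEqT, desc, eqPairFn_boolPair]

/-- Value of the polarity test on a descriptor. [folklore] -/
theorem polEqT_desc : polEqT (desc (tokRec t) P (tokRec t') Q) = [decide (t.pol = t'.pol)] := by
  simp [polEqT, desc, eqPairFn_boolPair]

/-- Value of the clause test on a descriptor. [folklore] -/
theorem clsEqT_desc : clsEqT (desc (tokRec t) P (tokRec t') Q) = [decide (Q = P)] := by
  simp [clsEqT, desc, eqPairFn_boolPair]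

end TestValues

/-! ### The adjacency emitter on column descriptors -/

/-- **Karp's adjacency emitter** on a descriptor `⟨row record, ⟨1^{i}, ⟨column record, 1^{j}⟩⟩⟩`
(token records with their clause numbers): the bit `[j ≠ i ∧ ¬(same variable ∧ opposite polarity)]`.
[cite: Karp1972, §4 (SATISFIABILITY ∝ CLIQUE: i ≠ j and σ ≠ δ̄)] -/
def adjE : List Bool → List Bool := andFn (notFn clsEqT) (notFn (andFn numEqT (notFn polEqT)))

/-- `adjE ∈ FP`. [cite: AroraBarakCC2009, §1.3] -/
theorem adjE_mem_FP : adjE ∈ FP :=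
  andFn_mem_FP (notFn_mem_FP clsEqT_mem_FP) (notFn_mem_FP (andFn_mem_FP numEqT_mem_FP (notFn_mem_FP polEqT_mem_FP)))

/-- `adjE` is one-bit. [folklore] -/
theorem oneBit_adjE : OneBit adjE :=
  oneBit_andFn (oneBit_notFn oneBit_clsEqT) (oneBit_notFn (oneBit_andFn oneBit_numEqT (oneBit_notFn oneBit_polEqT)))

/-- `adjE` emits at most one symbol. [folklore] -/
theorem length_adjE_le (d : List Bool) : (adjE d).length ≤ 1 := by
  rw [oneBit_adjE.length_eq]

/-- **Value of the emitter**: Karp's adjacency `compatB` of the two annotated occurrences.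
[cite: Karp1972, §4 (SATISFIABILITY ∝ CLIQUE)] -/
theorem adjE_desc (t t' : STok) (i j : ℕ) :
    adjE (desc (tokRec t) (ones i) (tokRec t') (ones j)) = [compatB (i, t.var, t.pol) (j, t'.var, t'.pol)] := by
  rw [adjE, andFn_apply (notFn_apply (clsEqT_desc t t' _ _))
    (notFn_apply (andFn_apply (numEqT_desc t t' _ _) (notFn_apply (polEqT_desc t t' _ _)))), compatB,
    show decide (ones j = ones i) = decide (j = i) from Bool.decide_congr CliqueNP.ones_inj]

/-! ### The clause bump: the running clause number -/

/-- The clause-number register after reading the record `a`: bumped iff `a` opens a clause (its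
flag field `sndPow 1 a` starts with `1`). [folklore] -/
def bumpOf (a Q : List Bool) : List Bool := if (sndPow 1 a).headD false then true :: Q else Q

/-- On a token record with a unary register: `1^{c + [first]}`. [folklore] -/
theorem bumpOf_tokRec (t : STok) (c : ℕ) : bumpOf (tokRec t) (ones c) = ones (c + t.first.toNat) := by
  rw [bumpOf, sndPow_one_tokRec]
  cases t.first <;> simp [ones, List.replicate_succ]

/-- The bump lengthens the register by at most one. [folklore] -/
theorem length_bumpOf_le (a Q : List Bool) : (bumpOf a Q).length ≤ Q.length + 1 := by
  unfold bumpOf; split_ifs <;> simp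

/-! ### The clause-counting row loop -/

/-- The row-loop state `⟨x, ⟨trow, ⟨P, ⟨rem, ⟨Q, out⟩⟩⟩⟩⟩`: ruler, row token record, row clause
register, remaining column records, column clause register, output. [folklore] -/
def rowSt (x trow P rem Q out : List Bool) : List Bool :=
  boolPair x (boolPair trow (boolPair P (boolPair rem (boolPair Q out))))

section RowLoop

variable {E : List Bool → List Bool} {cE : ℕ}

/-- On a row state `⟨x, ⟨trow, ⟨P, ⟨rem, ⟨Q, out⟩⟩⟩⟩⟩`: the bumped column register
`bumpOf (fstF rem) Q`. [folklore] -/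
def bumpQB : List Bool → List Bool :=
  iteFn (headBitFn ∘ sndPow 1 ∘ fstF ∘ nthF 3) (List.cons true ∘ nthF 4) (nthF 4)

/-- `bumpQB ∈ FP`. [folklore] -/
theorem bumpQB_mem_FP : bumpQB ∈ FP :=
  iteFn_mem_FP (comp_mem_FP headBitFn_mem_FP (comp_mem_FP (sndPow_mem_FP 1) (comp_mem_FP fstF_mem_FP (nthF_mem_FP 3))))
    (comp_mem_FP (cons_mem_FP true) (nthF_mem_FP 4)) (nthF_mem_FP 4)

/-- Value of `bumpQB`. [folklore] -/
theorem bumpQB_eq (w : List Bool) : bumpQB w = bumpOf (fstF (nthF 3 w)) (nthF 4 w) := by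
  rw [bumpQB, iteFn_apply (b := (sndPow 1 (fstF (nthF 3 w))).headD false) (by simp), bumpOf]
  split_ifs <;> rfl

/-- The column descriptor with the bumped register. [folklore] -/
def cdescB : List Bool → List Bool :=
  fanoutFn (nthF 1) (fanoutFn (nthF 2) (fanoutFn (fstF ∘ nthF 3) bumpQB))

/-- `cdescB ∈ FP`. [folklore] -/
theorem cdescB_mem_FP : cdescB ∈ FP :=
  fanoutFn_mem_FP (nthF_mem_FP 1) (fanoutFn_mem_FP (nthF_mem_FP 2)
    (fanoutFn_mem_FP (comp_mem_FP fstF_mem_FP (nthF_mem_FP 3)) bumpQB_mem_FP))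

variable (E) in
/-- **One round of the clause-counting row loop** with emitter `E`: if column records are left,
bump the clause register on a clause-opening record, emit `E` of the descriptor, drop the record.
[cite: AroraBarakCC2009, §1.3 (bounded loops)] -/
def crowStep : List Bool → List Bool :=
  iteFn (isNilFn ∘ nthF 3) id
    (fanoutFn (nthF 0) (fanoutFn (nthF 1) (fanoutFn (nthF 2) (fanoutFn (sndF ∘ nthF 3)
      (fanoutFn bumpQB (concatFn ∘ fanoutFn (sndPow 4) (E ∘ cdescB)))))))

/-- `crowStep E ∈ FP` for `E ∈ FP`. [folklore] -/
theorem crowStep_mem_FP (hE : E ∈ FP) : crowStep E ∈ FP :=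
  iteFn_mem_FP (comp_mem_FP isNilFn_mem_FP (nthF_mem_FP 3)) id_mem_FP
    (fanoutFn_mem_FP (nthF_mem_FP 0) (fanoutFn_mem_FP (nthF_mem_FP 1) (fanoutFn_mem_FP (nthF_mem_FP 2)
      (fanoutFn_mem_FP (comp_mem_FP sndF_mem_FP (nthF_mem_FP 3))
        (fanoutFn_mem_FP bumpQB_mem_FP
          (comp_mem_FP concatFn_mem_FP (fanoutFn_mem_FP (sndPow_mem_FP 4) (comp_mem_FP hE cdescB_mem_FP))))))))

/-- **A row-loop round lengthens no string by more than `cE + 13`.** [folklore] -/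
theorem length_crowStep_le (hcE : ∀ d, (E d).length ≤ cE) (w : List Bool) :
    (crowStep E w).length ≤ w.length + (cE + 13) := by
  rw [crowStep, iteFn_of_oneBit (oneBit_isNilFn.comp _)]
  split_ifs
  · simp
  · have h := length_fields5_le w
    have ha := length_fstF_sndF_le (nthF 3 w)
    have he := hcE (cdescB w)
    have hb := length_bumpOf_le (fstF (nthF 3 w)) (nthF 4 w)
    rw [← bumpQB_eq] at hb
    simp only [fanoutFn_apply, length_boolPair, List.length_append, Function.comp_apply,
      concatFn_boolPair] at *
    omega

/-- A finished row loop idles. [folklore] -/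
theorem crowStep_nil (x trow P Q out : List Bool) :
    crowStep E (rowSt x trow P [] Q out) = rowSt x trow P [] Q out := by
  rw [crowStep, iteFn_apply (b := true) (by simp [rowSt, isNilFn])]
  simp

/-- A running row loop emits one column, bumping the register on a clause-opening record. [folklore] -/
theorem crowStep_cons (x trow P a rem Q out : List Bool) :
    crowStep E (rowSt x trow P (boolPair a rem) Q out) =
      rowSt x trow P rem (bumpOf a Q) (out ++ E (desc trow P a (bumpOf a Q))) := by
  rw [crowStep, iteFn_apply (b := false) (by simp [rowSt, isNilFn, boolPair_ne_nil])]
  have hb : bumpQB (rowSt x trow P (boolPair a rem) Q out) = bumpOf a Q := by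
    rw [bumpQB_eq]; simp [rowSt]
  simp only [rowSt] at hb ⊢
  simp [cdescB, desc, hb]

variable (E) in
/-- The model of the row loop: the emitted columns for the records `l` from register `Q`. [folklore] -/
def crowM (trow P : List Bool) : List (List Bool) → List Bool → List Bool
  | [], _ => []
  | a :: l, Q => E (desc trow P a (bumpOf a Q)) ++ crowM trow P l (bumpOf a Q)

/-- The final register of the row loop. [folklore] -/
def cQEnd : List (List Bool) → List Bool → List Bool
  | [], Q => Q
  | a :: l, Q => cQEnd l (bumpOf a Q)

/-- **The row loop realises its model**: with at least `|l|` rounds, all records are consumed.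
[folklore] -/
theorem iterate_crowStep (x trow P : List Bool) : ∀ (l : List (List Bool)) (n : ℕ) (Q out : List Bool),
    l.length ≤ n → (crowStep E)^[n] (rowSt x trow P (body l) Q out) =
      rowSt x trow P [] (cQEnd l Q) (out ++ crowM E trow P l Q)
  | [], n, Q, out, _ => by
    rw [body_nil, Function.iterate_fixed (crowStep_nil x trow P Q out)]
    simp [crowM, cQEnd]
  | a :: l, 0, Q, out, h => by simp at h
  | a :: l, n + 1, Q, out, h => by
    rw [Function.iterate_succ_apply, body_cons, crowStep_cons, iterate_crowStep x trow P l n _ _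
      (by simpa using h)]
    simp [crowM, cQEnd, List.append_assoc]

/-- The output of the row loop grows by at most `cE` per round, from any state. [folklore] -/
theorem length_out_iterate_crowStep_le (hcE : ∀ d, (E d).length ≤ cE) (x trow P : List Bool) :
    ∀ (n : ℕ) (rem Q out : List Bool),
      (sndPow 4 ((crowStep E)^[n] (rowSt x trow P rem Q out))).length ≤ out.length + n * cE
  | 0, rem, Q, out => by simp [rowSt]
  | n + 1, rem, Q, out => by
    rw [Function.iterate_succ_apply]
    by_cases h : rem = []
    · subst h
      rw [crowStep_nil]
      exact (length_out_iterate_crowStep_le hcE x trow P n [] Q out).trans (by nlinarith)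
    · have hrem : rem = boolPair (fstF rem) (sndF rem) ∨ True := Or.inr trivial
      rw [crowStep, iteFn_apply (b := false) (by simp [rowSt, isNilFn, h])]
      have hst : fanoutFn (nthF 0) (fanoutFn (nthF 1) (fanoutFn (nthF 2) (fanoutFn (sndF ∘ nthF 3)
          (fanoutFn bumpQB (concatFn ∘ fanoutFn (sndPow 4) (E ∘ cdescB)))))) (rowSt x trow P rem Q out) =
          rowSt x trow P (sndF rem) (bumpQB (rowSt x trow P rem Q out)) (out ++ E (cdescB (rowSt x trow P rem Q out))) := by
        simp [rowSt]
      rw [hst]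
      refine (length_out_iterate_crowStep_le hcE x trow P n _ _ _).trans ?_
      have := hcE (cdescB (rowSt x trow P rem Q out))
      simp only [List.length_append]
      nlinarith

variable (E) in
/-- **The row function** with emitter `E`: `|x|` rounds of the row loop, then the output field.
[folklore] -/
def crowFn : List Bool → List Bool :=
  sndPow 4 ∘ fun w => (crowStep E)^[(X : Polynomial ℕ).eval (boolUnpair w).1.length] w

/-- `crowFn E ∈ FP`. [cite: AroraBarakCC2009, §1.3 (bounded loops)] -/
theorem crowFn_mem_FP (hE : E ∈ FP) (hcE : ∀ d, (E d).length ≤ cE) : crowFn E ∈ FP :=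
  comp_mem_FP (sndPow_mem_FP 4) (iterate_mem_FP (crowStep_mem_FP hE) (cE + 13) (length_crowStep_le hcE) X)

/-- **Value of the row function** on a coded record list with at most `|x|` records. [folklore] -/
theorem crowFn_apply (x trow P : List Bool) (l : List (List Bool)) (hl : l.length ≤ x.length) :
    crowFn E (rowSt x trow P (body l) [] []) = crowM E trow P l [] := by
  simp only [crowFn, Function.comp_apply]
  rw [show (boolUnpair (rowSt x trow P (body l) [] [])).1 = x by simp [rowSt], eval_X,
    iterate_crowStep x trow P l x.length [] [] hl]
  simp [rowSt]

/-- The row function's output is at most `cE |x|` long, on any row state. [folklore] -/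
theorem length_crowFn_rowSt_le (hcE : ∀ d, (E d).length ≤ cE) (x trow P rem Q : List Bool) :
    (crowFn E (rowSt x trow P rem Q [])).length ≤ x.length * cE := by
  simp only [crowFn, Function.comp_apply]
  rw [show (boolUnpair (rowSt x trow P rem Q [])).1 = x by simp [rowSt], eval_X]
  simpa using length_out_iterate_crowStep_le hcE x trow P x.length rem Q []

end RowLoop

/-! ### The clause-counting matrix loop -/

/-- The matrix-loop state `⟨x, ⟨A, ⟨remR, ⟨P, OUT⟩⟩⟩⟩`: ruler, all column records, remaining row
records, row clause register, output. [folklore] -/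
def matSt (x A remR P OUT : List Bool) : List Bool :=
  boolPair x (boolPair A (boolPair remR (boolPair P OUT)))

section MatLoop

variable {E : List Bool → List Bool} {cE : ℕ}

/-- On a matrix state: the bumped row register `bumpOf (fstF remR) P`. [folklore] -/
def bumpPB : List Bool → List Bool :=
  iteFn (headBitFn ∘ sndPow 1 ∘ fstF ∘ nthF 2) (List.cons true ∘ nthF 3) (nthF 3)

/-- `bumpPB ∈ FP`. [folklore] -/
theorem bumpPB_mem_FP : bumpPB ∈ FP :=
  iteFn_mem_FP (comp_mem_FP headBitFn_mem_FP (comp_mem_FP (sndPow_mem_FP 1) (comp_mem_FP fstF_mem_FP (nthF_mem_FP 2))))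
    (comp_mem_FP (cons_mem_FP true) (nthF_mem_FP 3)) (nthF_mem_FP 3)

/-- Value of `bumpPB`. [folklore] -/
theorem bumpPB_eq (w : List Bool) : bumpPB w = bumpOf (fstF (nthF 2 w)) (nthF 3 w) := by
  rw [bumpPB, iteFn_apply (b := (sndPow 1 (fstF (nthF 2 w))).headD false) (by simp), bumpOf]
  split_ifs <;> rfl

/-- The initial row state for the current row record: `⟨x, ⟨a, ⟨bumped P, ⟨A, ⟨ε, ε⟩⟩⟩⟩⟩`. [folklore] -/
def crowInitB : List Bool → List Bool :=
  fanoutFn (nthF 0) (fanoutFn (fstF ∘ nthF 2) (fanoutFn bumpPB (fanoutFn (nthF 1) fun _ => boolPair [] [])))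

/-- `crowInitB ∈ FP`. [folklore] -/
theorem crowInitB_mem_FP : crowInitB ∈ FP :=
  fanoutFn_mem_FP (nthF_mem_FP 0) (fanoutFn_mem_FP (comp_mem_FP fstF_mem_FP (nthF_mem_FP 2))
    (fanoutFn_mem_FP bumpPB_mem_FP (fanoutFn_mem_FP (nthF_mem_FP 1) (const_mem_FP _))))

/-- `crowInitB` is a row state on every input. [folklore] -/
theorem crowInitB_eq (w : List Bool) :
    crowInitB w = rowSt (fstF w) (fstF (nthF 2 w)) (bumpPB w) (nthF 1 w) [] [] := by
  simp [crowInitB, rowSt]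

/-- `crowInitB` on a matrix state. [folklore] -/
theorem crowInitB_matSt (x A remR P OUT : List Bool) :
    crowInitB (matSt x A remR P OUT) = rowSt x (fstF remR) (bumpOf (fstF remR) P) A [] [] := by
  rw [crowInitB_eq, bumpPB_eq]
  simp [matSt]

variable (E) in
/-- **One round of the clause-counting matrix loop**: if row records are left, bump the row
register on a clause-opening record, emit the row of the first record against all column records,
drop it. [cite: AroraBarakCC2009, §1.3 (bounded loops)] -/
def cmatStep : List Bool → List Bool :=
  iteFn (isNilFn ∘ nthF 2) id
    (fanoutFn (nthF 0) (fanoutFn (nthF 1) (fanoutFn (sndF ∘ nthF 2)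
      (fanoutFn bumpPB (concatFn ∘ fanoutFn (sndPow 3) (crowFn E ∘ crowInitB))))))

variable (E) in
/-- The model of the matrix loop: one row per row record, against all column records `all`, the row
register bumped on clause-opening records. [folklore] -/
def cmatM (all : List (List Bool)) : List (List Bool) → List Bool → List Bool
  | [], _ => []
  | a :: l, P => crowM E a (bumpOf a P) all [] ++ cmatM all l (bumpOf a P)

/-- `cmatStep E ∈ FP`. [folklore] -/
theorem cmatStep_mem_FP (hE : E ∈ FP) (hcE : ∀ d, (E d).length ≤ cE) : cmatStep E ∈ FP :=
  iteFn_mem_FP (comp_mem_FP isNilFn_mem_FP (nthF_mem_FP 2)) id_mem_FP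
    (fanoutFn_mem_FP (nthF_mem_FP 0) (fanoutFn_mem_FP (nthF_mem_FP 1)
      (fanoutFn_mem_FP (comp_mem_FP sndF_mem_FP (nthF_mem_FP 2))
        (fanoutFn_mem_FP bumpPB_mem_FP
          (comp_mem_FP concatFn_mem_FP (fanoutFn_mem_FP (sndPow_mem_FP 3) (comp_mem_FP (crowFn_mem_FP hE hcE) crowInitB_mem_FP)))))))

/-- The emitted row is at most `cE |x|` long, on every input. [folklore] -/
theorem length_crowFn_crowInitB_le (hcE : ∀ d, (E d).length ≤ cE) (w : List Bool) :
    (crowFn E (crowInitB w)).length ≤ (fstF w).length * cE := by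
  rw [crowInitB_eq]
  exact length_crowFn_rowSt_le hcE _ _ _ _ _

/-- The matrix loop keeps the ruler. [folklore] -/
theorem fstF_cmatStep (w : List Bool) : (boolUnpair (cmatStep E w)).1 = (boolUnpair w).1 := by
  rw [cmatStep, iteFn_of_oneBit (oneBit_isNilFn.comp _)]
  split_ifs
  · rfl
  · simp [fstF]

/-- **Linear growth of a matrix-loop round.** [folklore] -/
theorem length_cmatStep_le (hcE : ∀ d, (E d).length ≤ cE) (w : List Bool) :
    (cmatStep E w).length ≤ w.length + (cE + 13) * ((boolUnpair w).1.length + 1) := by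
  rw [cmatStep, iteFn_of_oneBit (oneBit_isNilFn.comp _)]
  split_ifs
  · simp
  · have h := length_fields4_le w
    have ha := length_fstF_sndF_le (nthF 2 w)
    have ht := length_crowFn_crowInitB_le hcE w
    have hb := length_bumpOf_le (fstF (nthF 2 w)) (nthF 3 w)
    rw [← bumpPB_eq] at hb
    have hx : (fstF w).length = (boolUnpair w).1.length := rfl
    simp only [nthF_zero, fanoutFn_apply, length_boolPair, List.length_append, Function.comp_apply,
      concatFn_boolPair] at *
    nlinarith

/-- A finished matrix loop idles. [folklore] -/
theorem cmatStep_nil (x A P OUT : List Bool) : cmatStep E (matSt x A [] P OUT) = matSt x A [] P OUT := by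
  rw [cmatStep, iteFn_apply (b := true) (by simp [matSt, isNilFn])]
  simp

/-- A running matrix loop emits one row. [folklore] -/
theorem cmatStep_cons (x a remR P OUT : List Bool) (all : List (List Bool)) (hall : all.length ≤ x.length) :
    cmatStep E (matSt x (body all) (boolPair a remR) P OUT) =
      matSt x (body all) remR (bumpOf a P) (OUT ++ crowM E a (bumpOf a P) all []) := by
  rw [cmatStep, iteFn_apply (b := false) (by simp [matSt, isNilFn, boolPair_ne_nil])]
  have h : crowInitB (matSt x (body all) (boolPair a remR) P OUT) = rowSt x a (bumpOf a P) (body all) [] [] := by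
    rw [crowInitB_matSt, fstF_boolPair]
  have hb : bumpPB (matSt x (body all) (boolPair a remR) P OUT) = bumpOf a P := by
    rw [bumpPB_eq]; simp [matSt]
  simp only [fanoutFn_apply, h, crowFn_apply x a _ all hall, Function.comp_apply, concatFn_boolPair]
  simp only [matSt] at hb ⊢
  simp [hb]

/-- **The matrix loop realises its model.** [folklore] -/
theorem iterate_cmatStep (x : List Bool) (all : List (List Bool)) (hall : all.length ≤ x.length) :
    ∀ (l : List (List Bool)) (n : ℕ) (P OUT : List Bool), l.length ≤ n →
      (cmatStep E)^[n] (matSt x (body all) (body l) P OUT) =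
        matSt x (body all) [] (cQEnd l P) (OUT ++ cmatM E all l P)
  | [], n, P, OUT, _ => by
    rw [body_nil, Function.iterate_fixed (cmatStep_nil x _ P OUT)]
    simp [cmatM, cQEnd]
  | a :: l, 0, P, OUT, h => by simp at h
  | a :: l, n + 1, P, OUT, h => by
    rw [Function.iterate_succ_apply, body_cons, cmatStep_cons x a _ P OUT all hall,
      iterate_cmatStep x all hall l n _ _ (by simpa using h)]
    simp [cmatM, cQEnd, List.append_assoc]

/-- The initial matrix state from `⟨x, A⟩`: `⟨x, ⟨A, ⟨A, ⟨ε, ε⟩⟩⟩⟩`. [folklore] -/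
def matInitB : List Bool → List Bool :=
  fanoutFn fstF (fanoutFn sndF (fanoutFn sndF fun _ => boolPair [] []))

/-- `matInitB ∈ FP`. [folklore] -/
theorem matInitB_mem_FP : matInitB ∈ FP :=
  fanoutFn_mem_FP fstF_mem_FP (fanoutFn_mem_FP sndF_mem_FP (fanoutFn_mem_FP sndF_mem_FP (const_mem_FP _)))

/-- `matInitB ⟨x, A⟩ = ⟨x, ⟨A, ⟨A, ⟨ε, ε⟩⟩⟩⟩`. [folklore] -/
theorem matInitB_boolPair (x A : List Bool) : matInitB (boolPair x A) = matSt x A A [] [] := by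
  simp [matInitB, matSt]

variable (E) in
/-- **The matrix function**: `|x|` rounds of the matrix loop from the initial state, then the output
field. [folklore] -/
def cmatFn : List Bool → List Bool :=
  sndPow 3 ∘ (fun w => (cmatStep E)^[(X : Polynomial ℕ).eval (boolUnpair w).1.length] w) ∘ matInitB

/-- **`cmatFn E ∈ FP`.** [cite: AroraBarakCC2009, §1.3 (bounded loops)] -/
theorem cmatFn_mem_FP (hE : E ∈ FP) (hcE : ∀ d, (E d).length ≤ cE) : cmatFn E ∈ FP :=
  comp_mem_FP (sndPow_mem_FP 3) (comp_mem_FP (iterate_mem_FP_of_growth (cmatStep_mem_FP hE hcE) _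
    fstF_cmatStep (length_cmatStep_le hcE) X) matInitB_mem_FP)

/-- **Value of the matrix function** on `⟨x, coded records⟩` with at most `|x|` records. [folklore] -/
theorem cmatFn_apply (x : List Bool) (all : List (List Bool)) (hall : all.length ≤ x.length) :
    cmatFn E (boolPair x (body all)) = cmatM E all all [] := by
  simp only [cmatFn, Function.comp_apply, matInitB_boolPair]
  rw [show (boolUnpair (matSt x (body all) (body all) [] [])).1 = x by simp [matSt], eval_X,
    iterate_cmatStep x all hall all x.length [] [] hall]
  simp [matSt]

end MatLoop

/-! ### The reduction function -/

/-- `⟨z, coded token records⟩` from the tokenizer output record. [folklore] -/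
def itemsInB : List Bool → List Bool := fanoutFn (nthF 0) (sndPow 7)

/-- `itemsInB ∈ FP`. [folklore] -/
theorem itemsInB_mem_FP : itemsInB ∈ FP := fanoutFn_mem_FP (nthF_mem_FP 0) (sndPow_mem_FP 7)

/-- `itemsInB` on the tokenizer output. [folklore] -/
theorem itemsInB_tokFn (z : List Bool) : itemsInB (tokFn z) = boolPair z (body ((toks z).map tokRec)) := by
  rw [itemsInB, fanoutFn_apply, sndPow_seven_tokFn, tokFn_apply]
  simp [TokSt.enc]

/-- The instance code `⟨⟨bin L, adjacency bits⟩, bin m⟩` from the tokenizer output record.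
[cite: Karp1972, §4 (SATISFIABILITY ∝ CLIQUE: k = p, the number of clauses)] -/
def redCoreB : List Bool → List Bool :=
  fanoutFn (fanoutFn (popCountFn ∘ nthF 6) (cmatFn adjE ∘ itemsInB)) (popCountFn ∘ nthF 7)

/-- `redCoreB ∈ FP`. [cite: AroraBarakCC2009, §1.3] -/
theorem redCoreB_mem_FP : redCoreB ∈ FP :=
  fanoutFn_mem_FP (fanoutFn_mem_FP (comp_mem_FP popCountFn_mem_FP (nthF_mem_FP 6))
    (comp_mem_FP (cmatFn_mem_FP adjE_mem_FP length_adjE_le) itemsInB_mem_FP)) (comp_mem_FP popCountFn_mem_FP (nthF_mem_FP 7))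

/-- **The unguarded reduction** `z ↦ ⟨⟨bin L, adjacency bits⟩, bin m⟩` of the token list read off `z`.
[cite: Karp1972, §4 (SATISFIABILITY ∝ CLIQUE)] -/
def redFn : List Bool → List Bool := redCoreB ∘ tokFn

/-- **`redFn ∈ FP`.** [cite: AroraBarakCC2009, §1.3] -/
theorem redFn_mem_FP : redFn ∈ FP := comp_mem_FP redCoreB_mem_FP tokFn_mem_FP

/-- Value of `redFn`: the fields of the instance code, the bits still as the matrix model. [folklore] -/
theorem redFn_eq (z : List Bool) :
    redFn z = boolPair (boolPair (encodeNat (toks z).length) (cmatM adjE ((toks z).map tokRec) ((toks z).map tokRec) []))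
      (encodeNat (clauseCount z)) := by
  rw [redFn, Function.comp_apply, redCoreB, fanoutFn_apply, fanoutFn_apply, Function.comp_apply, nthF_six_tokFn,
    Function.comp_apply, itemsInB_tokFn, cmatFn_apply z _ (by simpa using length_toks_le z), Function.comp_apply,
    nthF_seven_tokFn, popCountFn_apply, popCountFn_apply, List.count_replicate_self, List.count_replicate_self]

/-! ### The emitted bits are the adjacency bits of Karp's graph -/

/-- The running clause numbers of a token list read from counter `c`: bumped at each clause-opening
token. [folklore] -/
def clsSeq : ℕ → List STok → List ℕ
  | _, [] => []
  | c, t :: l => (c + t.first.toNat) :: clsSeq (c + t.first.toNat) l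

/-- `clsSeq` keeps the length. [folklore] -/
@[simp] theorem length_clsSeq : ∀ (c : ℕ) (l : List STok), (clsSeq c l).length = l.length
  | _, [] => rfl
  | c, t :: l => by rw [clsSeq, List.length_cons, length_clsSeq, List.length_cons]

/-- **The annotated occurrences of a token list**: each token with its clause number.
[cite: Karp1972, §4 (the nodes ⟨σ, i⟩)] -/
def annFrom (c : ℕ) (l : List STok) : List Ann :=
  List.zipWith (fun t k => ((k, t.var, t.pol) : Ann)) l (clsSeq c l)

/-- `annFrom` of a cons. [folklore] -/
theorem annFrom_cons (c : ℕ) (t : STok) (l : List STok) :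
    annFrom c (t :: l) = (c + t.first.toNat, t.var, t.pol) :: annFrom (c + t.first.toNat) l := rfl

/-- `annFrom` keeps the length. [folklore] -/
@[simp] theorem length_annFrom (c : ℕ) (l : List STok) : (annFrom c l).length = l.length := by
  simp [annFrom]

/-- The row model on token records with unary registers is a `zipWith` along the running clause
numbers. [folklore] -/
theorem crowM_tokRec (E : List Bool → List Bool) (trow P : List Bool) (f : STok → ℕ → List Bool)
    (hE : ∀ t' q, E (desc trow P (tokRec t') (ones q)) = f t' q) :
    ∀ (l : List STok) (c : ℕ), crowM E trow P (l.map tokRec) (ones c) = (List.zipWith f l (clsSeq c l)).flatten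
  | [], _ => rfl
  | t :: l, c => by
    rw [List.map_cons, crowM, bumpOf_tokRec, hE, clsSeq, List.zipWith_cons_cons, List.flatten_cons,
      crowM_tokRec E trow P f hE l]

/-- The matrix model on token records is a `zipWith` of rows along the running clause numbers.
[folklore] -/
theorem cmatM_tokRec (E : List Bool → List Bool) (all : List (List Bool)) (g : STok → ℕ → List Bool)
    (hg : ∀ t p, crowM E (tokRec t) (ones p) all [] = g t p) :
    ∀ (l : List STok) (c : ℕ), cmatM E all (l.map tokRec) (ones c) = (List.zipWith g l (clsSeq c l)).flatten
  | [], _ => rfl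
  | t :: l, c => by
    rw [List.map_cons, cmatM, bumpOf_tokRec, hg, clsSeq, List.zipWith_cons_cons, List.flatten_cons,
      cmatM_tokRec E all g hg l]

/-- A `zipWith` along the running clause numbers is a map over the annotated occurrences. [folklore] -/
theorem zipWith_clsSeq_eq_map {β : Type} (g : Ann → β) (c : ℕ) (l : List STok) :
    List.zipWith (fun t k => g (k, t.var, t.pol)) l (clsSeq c l) = (annFrom c l).map g := by
  rw [annFrom, List.map_zipWith]

/-- Flattening singletons. [folklore] -/
theorem flatten_map_singleton {β γ : Type} (f : β → γ) (l : List β) : (l.map fun b => [f b]).flatten = l.map f := by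
  induction l with
  | nil => rfl
  | cons b l ih => simp [ih]

/-- **The bits emitted by the matrix loop**: row by row, Karp's adjacency of the annotated
occurrences. [cite: Karp1972, §4 (SATISFIABILITY ∝ CLIQUE)] -/
theorem cmatM_adjE_eq (T : List STok) :
    cmatM adjE (T.map tokRec) (T.map tokRec) [] =
      ((annFrom 0 T).map fun x => (annFrom 0 T).map (compatB x)).flatten := by
  have hrow : ∀ (t : STok) (p : ℕ), crowM adjE (tokRec t) (ones p) (T.map tokRec) [] =
      (annFrom 0 T).map (compatB (p, t.var, t.pol)) := fun t p => by
    rw [show ([] : List Bool) = ones 0 from rfl,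
      crowM_tokRec adjE (tokRec t) (ones p) (fun t' q => [compatB (p, t.var, t.pol) (q, t'.var, t'.pol)])
        (fun t' q => adjE_desc t t' p q) T 0,
      zipWith_clsSeq_eq_map (fun y => [compatB (p, t.var, t.pol) y]) 0 T, flatten_map_singleton]
  rw [show ([] : List Bool) = ones 0 from rfl, cmatM_tokRec adjE (T.map tokRec) _ hrow T 0,
    zipWith_clsSeq_eq_map (fun x => (annFrom 0 T).map (compatB x)) 0 T]

/-- `List.ofFn` over the positions of a list is a map. [folklore] -/
theorem ofFn_getElem_map {β γ : Type} (l : List β) (f : β → γ) :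
    (List.ofFn fun i : Fin l.length => f l[i]) = l.map f :=
  List.ext_getElem (by simp) fun i h1 h2 => by simp

/-- **The adjacency bits of Karp's graph**, row by row. [folklore] -/
theorem adjBits_graphOf (A : List Ann) :
    adjBits A.length (graphOf A) = (A.map fun x => A.map (compatB x)).flatten := by
  rw [adjBits, List.ofFn_mul]
  congr 1
  rw [← ofFn_getElem_map A (fun x => A.map (compatB x))]
  refine List.ofFn_inj.2 (funext fun i => ?_)
  rw [← ofFn_getElem_map A (compatB A[i])]
  refine List.ofFn_inj.2 (funext fun j => ?_)
  have hi : (⟨(i : ℕ) * A.length + j, flat_lt i j⟩ : Fin (A.length * A.length)).divNat = i := Fin.ext (flat_div i j)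
  have hj : (⟨(i : ℕ) * A.length + j, flat_lt i j⟩ : Fin (A.length * A.length)).modNat = j := Fin.ext (flat_mod i j)
  rw [hi, hj]
  exact (@Bool.decide_congr _ _ (Classical.propDecidable _) _ (graphOf_adj A i j)).trans Bool.decide_eq_true

/-- **Value of the unguarded reduction on EVERY string**: the code of Karp's instance
`(⟨L, G⟩, m)` for the token list read off `z`. [cite: Karp1972, §4 (SATISFIABILITY ∝ CLIQUE)] -/
theorem redFn_apply (z : List Bool) :
    redFn z = instEnc.encode (⟨(annFrom 0 (toks z)).length, graphOf (annFrom 0 (toks z))⟩, clauseCount z) := by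
  rw [instEnc_encode_eq, adjBits_graphOf, ← cmatM_adjE_eq, length_annFrom, redFn_eq]

/-! ### On the code of a CNF: the annotated occurrences are those of the formula -/

/-- The non-opening tokens of a clause contribute its annotated literals with the current number.
[folklore] -/
theorem annFrom_clauseTokens_false (k : ℕ) (rest : List STok) : ∀ cs : Clause ℕ,
    annFrom k (clauseTokens false (cs.map strLit) ++ rest) = cs.map (annLit k) ++ annFrom k rest
  | [] => rfl
  | l :: cs => by
    rw [List.map_cons, clauseTokens, List.cons_append, annFrom_cons]
    dsimp only
    rw [Bool.toNat_false, Nat.add_zero, annFrom_clauseTokens_false k rest cs]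
    rfl

/-- **The annotated occurrences read off the tokens of `φ` are `annot k φ`.** [folklore] -/
theorem annFrom_tokensStr : ∀ (φ : CNF ℕ) (k : ℕ), annFrom k (tokensStr φ) = annot k φ
  | [], _ => rfl
  | c :: φ, k => by
    rw [tokensStr_cons, annot]
    cases c with
    | nil =>
      rw [if_pos rfl]
      exact annFrom_tokensStr φ k
    | cons l cs =>
      rw [clauseTokensStr, List.map_cons, clauseTokens, List.cons_append, annFrom_cons, if_neg (List.cons_ne_nil _ _)]
      dsimp only
      rw [Bool.toNat_true, annFrom_clauseTokens_false, annFrom_tokensStr φ (k + 1), List.map_cons]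
      rfl

/-! ### `SAT ≤ₚ CLIQUE` -/

open scoped Notation
open NegCNF KSATRed

/-- The code of the no-instance `(⟨0, ⊥⟩, 1)`: no graph on `Fin 0` has a `1`-clique. [folklore] -/
def badClique : List Bool := instEnc.encode (⟨0, ⊥⟩, 1)

/-- `badClique ∉ CLIQUE`. [folklore] -/
theorem badClique_not_mem_CLIQUE : badClique ∉ CLIQUE := by
  intro h
  change instEnc.encode _ ∈ instEnc.toLanguage cliqueSet at h
  rw [Encoding.mem_toLanguage_iff] at h
  exact h (SimpleGraph.cliqueFree_of_card_lt (by simp))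

/-- **The guarded reduction** `SAT → CLIQUE`: a canonical CNF code (`isCanonFn`) goes through
`redFn`, any other string to `badClique`. [cite: Karp1972, §4 (SATISFIABILITY ∝ CLIQUE) and Lemma 2] -/
def satToCliqueFn : List Bool → List Bool := iteFn isCanonFn redFn fun _ => badClique

/-- **`satToCliqueFn ∈ FP`.** [cite: AroraBarakCC2009, §1.3] -/
theorem satToCliqueFn_mem_FP : satToCliqueFn ∈ FP :=
  iteFn_mem_FP isCanonFn_mem_FP redFn_mem_FP (const_mem_FP _)

/-- **On the code of `φ`**: the code of Karp's instance `(⟨|N|, graphOf (annot 0 φ)⟩, |φ|)`.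
[cite: Karp1972, §4 (SATISFIABILITY ∝ CLIQUE)] -/
theorem satToCliqueFn_encode (φ : CNF ℕ) :
    satToCliqueFn (encodingCNF.encode φ) = instEnc.encode (⟨(annot 0 φ).length, graphOf (annot 0 φ)⟩, φ.length) := by
  have hc : isCanonFn (encodingCNF.encode φ) = [true] := by
    rw [isCanonFn_apply, decCNF_encode]; simp
  rw [satToCliqueFn, iteFn_apply_true hc, redFn_apply, clauseCount_encode, toks_encode, annFrom_tokensStr]

/-- On a non-code: `badClique`. [folklore] -/
theorem satToCliqueFn_of_not_canon {x : List Bool} (hx : encodingCNF.encode (decCNF x) ≠ x) :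
    satToCliqueFn x = badClique := by
  have hc : isCanonFn x = [false] := by rw [isCanonFn_apply]; simp [hx]
  rw [satToCliqueFn, iteFn_apply_false hc]

/-- **Karp 1972: `SATISFIABILITY ∝ CLIQUE`** for the tree's languages: `SAT ≤ₚ CLIQUE` by the
polynomial-time map `satToCliqueFn` (`KarpClique.karp_clique_iff_annot` on codes, the no-instance on
non-codes). [cite: Karp1972, §4 (Main Theorem, proof: SATISFIABILITY ∝ CLIQUE)] -/
theorem SAT_karpReducible_CLIQUE : SAT ≤ₚ CLIQUE := by
  refine ⟨satToCliqueFn, satToCliqueFn_mem_FP, fun x => ?_⟩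
  -- the goal speaks of `Set` membership (`Reductions.PolyTimeReducible`); restate it for languages
  show x ∈ SAT ↔ satToCliqueFn x ∈ CLIQUE
  by_cases hx : encodingCNF.encode (decCNF x) = x
  · rw [← hx, mem_SAT_iff, satToCliqueFn_encode]
    change _ ↔ instEnc.encode _ ∈ instEnc.toLanguage cliqueSet
    rw [Encoding.mem_toLanguage_iff]
    exact (karp_clique_iff_annot (decCNF x)).symm
  · rw [satToCliqueFn_of_not_canon hx]
    exact ⟨fun h => (hx (encode_decCNF_of_mem h)).elim, fun h => (badClique_not_mem_CLIQUE h).elim⟩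

end KarpClique

end Literature.Computability.Complexity

end
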